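import Mathlib
import Summits.KontsevichZagierPeriods.KontsevichZagierPeriods.Theorems.TorsionLogsNeronTorsionSectorStubTranslationStep
import Summits.KontsevichZagierPeriods.KontsevichZagierPeriods.Theorems.TorsionLogsNeronTorsionSectorStubCornerChartLower
import Summits.KontsevichZagierPeriods.KontsevichZagierPeriods.Theorems.HyperbolicBlochOffTetraSectorKernelRungZeroLogRelations
import HarnessLib

/-!
# Stub `stub_cellStepInst` — crux `TorsionLogs.NeronTorsionSector`, line `registered` (block S5)

The CELL RECURSION `c_{j+1} ≡ c_j + [(al,ar), (q_{j+1} − q_j)/√f]` of the translation chain on the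
identity component of the real curve `y² = f(x) = 4x³ − g₂x − g₃`: the source cell
`Csrc = [(al,ar) × (b,c), h(x′) dx dx′/(√f(x) √f(x′))]` (`h(x) = (g₂x + 2g₃)/(4x²)` the regular
second-kind density, `(b,c) = (x_{j+1}, x_j)` a row of the torsion grid, `j ≥ 1`), the target cell
`Ctgt` over the next row `(b′,c′) = τ((b,c))` (`τ` the lower-branch translation by `P₁`, increasing on
`[b,c]`, Haar invariant: `|τ′|√f = √f∘τ`), and the output `rO = [(al,ar), (Qf b − Qf c)/√f]`
(`Qf′ = (h∘τ − h)/(−√f)` the third-kind potential) satisfy `[Ctgt] − [Csrc] − [rO] ∈ KZ.relations`.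

This is ONE application of the landed generic translation step `stub_translationStep` with
`φ = id` on `A = A′ = (al, ar)` (`φ′ = 1`), `ψ = τ` on `B = (b,c) → B′ = (b′,c′)`, `J = [b,c]`, all
four weights `1/√f`, both kernels `h`, constant fibres `c ≡ b`, `d ≡ c`, potential `Q = Qf`.

References: M. Kontsevich, D. Zagier, *Periods* (2001), §1.2 rules (1)–(3); J. Bochnak, M. Coste,
M.-F. Roy, *Real Algebraic Geometry* (1998), §2.2, Prop. 2.2.6.
-/

noncomputable section

-- `Summit.KontsevichZagierPeriods.KontsevichZagierPeriods.…` is the tree's mandated layout (single-conjunct summit).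
set_option linter.dupNamespace false

open Set MeasureTheory MvPolynomial
open Literature.NumberTheory.Transcendental Literature.ModelTheory.ExponentialFields
open Summit.KontsevichZagierPeriods.HyperbolicBloch.OffTetraSectorKernel (isSemialgebraic_logIvl)

namespace Summit.KontsevichZagierPeriods.KontsevichZagierPeriods.Cruxes.NeronTorsionSector.Translation

/-- **The regular second-kind density `h(x) = (g₂x + 2g₃)/(4x²)` in one coordinate is
`ℚ`-semialgebraic** on every `ℚ`-semialgebraic `s ⊆ ℝ¹` avoiding `x = 0` (algebraic constants are
`ℚ`-definable, `isSemialgebraicFunOn_const_of_isAlgebraic`; closure under `+`, `*`, `/`).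
[cite: BochnakCosteRoy1998, Prop. 2.2.6] -/
theorem cellStep_isSemialgebraicFunOn_kernel {s : Set (Fin 1 → ℝ)} (hs : IsSemialgebraic ℚ s)
    {g₂ g₃ : ℝ} (h₂ : IsAlgebraic ℚ g₂) (h₃ : IsAlgebraic ℚ g₃) (h0 : ∀ t ∈ s, t 0 ≠ 0) :
    IsSemialgebraicFunOn ℚ s (fun t => (g₂ * t 0 + 2 * g₃) / (4 * t 0 ^ 2)) := by
  have hX : IsSemialgebraicFunOn ℚ s (fun t => t 0) :=
    (isSemialgebraicFunOn_aeval hs (X 0)).congr fun t _ => by simp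
  have h2 : IsSemialgebraicFunOn ℚ s (fun _ => (2 : ℝ)) :=
    (isSemialgebraicFunOn_aeval hs (C 2)).congr fun t _ => by simp
  have hden : IsSemialgebraicFunOn ℚ s (fun t => 4 * t 0 ^ 2) :=
    (isSemialgebraicFunOn_aeval hs (C 4 * X 0 ^ 2)).congr fun t _ => by simp
  have hnum : IsSemialgebraicFunOn ℚ s (fun t => g₂ * t 0 + 2 * g₃) :=
    (IsSemialgebraicFunOn.add_holds
      (IsSemialgebraicFunOn.mul_holds (isSemialgebraicFunOn_const_of_isAlgebraic hs h₂) hX)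
      (IsSemialgebraicFunOn.mul_holds h2 (isSemialgebraicFunOn_const_of_isAlgebraic hs h₃))).congr
      fun t _ => rfl
  exact hnum.div hden fun t ht => mul_ne_zero four_ne_zero (pow_ne_zero 2 (h0 t ht))

/-- **The image of the open box `(al,ar) × (b,c)` under `(x, x′) ↦ (x, τ x′)` is the open box
`(al,ar) × (b′,c′)`** when `τ` maps `(b,c)` onto `(b′,c′)`. [folklore] -/
theorem cellStep_image_box {al ar b c b' c' : ℝ} {τ : ℝ → ℝ}
    (hτimg : τ '' Set.Ioo b c = Set.Ioo b' c') :
    {z : Fin 2 → ℝ | (al < z 0 ∧ z 0 < ar) ∧ b' < z 1 ∧ z 1 < c'} =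
      (fun z : Fin 2 → ℝ => (![z 0, τ (z 1)] : Fin 2 → ℝ)) ''
        {z : Fin 2 → ℝ | (al < z 0 ∧ z 0 < ar) ∧ b < z 1 ∧ z 1 < c} := by
  ext z
  simp only [Set.mem_setOf_eq, Set.mem_image]
  constructor
  · rintro ⟨hz0, hz1, hz2⟩
    obtain ⟨y, hy, hyz⟩ : z 1 ∈ τ '' Set.Ioo b c := by
      rw [hτimg]
      exact ⟨hz1, hz2⟩
    refine ⟨![z 0, y], ?_, ?_⟩
    · simp only [Matrix.cons_val_zero, Matrix.cons_val_one]
      exact ⟨hz0, hy⟩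
    · exact funext (Fin.forall_fin_two.mpr ⟨by simp, by simpa using hyz⟩)
  · rintro ⟨w, ⟨hw0, hw1, hw2⟩, rfl⟩
    have hτw : τ (w 1) ∈ Set.Ioo b' c' := by
      rw [← hτimg]
      exact Set.mem_image_of_mem τ ⟨hw1, hw2⟩
    simp only [Matrix.cons_val_zero, Matrix.cons_val_one]
    exact ⟨hw0, hτw⟩

/-- **STUB S5 (`stub_cellStepInst`, size M) — the cell recursion `c_{j+1} ≡ c_j + [(al,ar), (q_{j+1} − q_j)/√f]`.**
Source cell `[(al,ar) × (b,c), h(x′)/(√f√f′)]` (`(b,c) = (x_{j+1}, x_j)`, `j ≥ 1`), target cell over the next row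
`(b′,c′) = τ((b,c))`; `stub_translationStep` with `φ = id` on `(al, ar)`, `ψ = τ` on `(b,c)` (increasing), weights
`1/√f`, kernels `h`, constant fibres `(b, c)`, potential `Qf`. [cite: KontsevichZagier2001, §1.2] -/
theorem stub_cellStepInst :
    ∀ (g₂ g₃ e₁ al ar b c b' c' Cb : ℝ) (f τ τ' Qf : ℝ → ℝ)
      (Csrc Ctgt : Literature.NumberTheory.Transcendental.KZ.IntegralRep 2)
      (rO : Literature.NumberTheory.Transcendental.KZ.IntegralRep 1),
    (∀ x, f x = 4 * x ^ 3 - g₂ * x - g₃) → IsAlgebraic ℚ g₂ → IsAlgebraic ℚ g₃ →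
    IsAlgebraic ℚ al → IsAlgebraic ℚ ar → IsAlgebraic ℚ b → IsAlgebraic ℚ c → IsAlgebraic ℚ b' → IsAlgebraic ℚ c' →
    0 < e₁ → e₁ < al → al < ar → e₁ < b → b < c → e₁ ≤ b' → b' < c' → (∀ x, e₁ < x → 0 < f x) →
    (∀ x, e₁ < x → |(g₂ * x + 2 * g₃) / (4 * x ^ 2)| ≤ Cb) →
    MeasureTheory.IntegrableOn (fun t => (Real.sqrt (f t))⁻¹) (Set.Ioo al ar) →
    MeasureTheory.IntegrableOn (fun t => (Real.sqrt (f t))⁻¹) (Set.Ioo b c) →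
    StrictMonoOn τ (Set.Icc b c) → τ '' Set.Ioo b c = Set.Ioo b' c' →
    (∀ x ∈ Set.Ioo b c, HasDerivAt τ (τ' x) x ∧ |τ' x| * Real.sqrt (f x) = Real.sqrt (f (τ x))) →
    IsSemialgebraicFunOn ℚ {t : Fin 1 → ℝ | t 0 ∈ Set.Ioo b c} (fun t => τ (t 0)) →
    IsSemialgebraicFunOn ℚ {t : Fin 1 → ℝ | t 0 ∈ Set.Icc b c} (fun t => Qf (t 0)) →
    ContinuousOn Qf (Set.Icc b c) →
    (∀ x ∈ Set.Ioo b c, HasDerivAt Qf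
      (((g₂ * τ x + 2 * g₃) / (4 * τ x ^ 2) - (g₂ * x + 2 * g₃) / (4 * x ^ 2)) / (-Real.sqrt (f x))) x) →
    Csrc.domain = {z | (al < z 0 ∧ z 0 < ar) ∧ b < z 1 ∧ z 1 < c} →
    Set.EqOn Csrc.integrand
      (fun z => (g₂ * z 1 + 2 * g₃) / (4 * (z 1) ^ 2) / (Real.sqrt (f (z 0)) * Real.sqrt (f (z 1)))) Csrc.domain →
    Ctgt.domain = {z | (al < z 0 ∧ z 0 < ar) ∧ b' < z 1 ∧ z 1 < c'} →
    Set.EqOn Ctgt.integrand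
      (fun z => (g₂ * z 1 + 2 * g₃) / (4 * (z 1) ^ 2) / (Real.sqrt (f (z 0)) * Real.sqrt (f (z 1)))) Ctgt.domain →
    rO.domain = {t | al < t 0 ∧ t 0 < ar} →
    Set.EqOn rO.integrand (fun t => (Qf b - Qf c) / Real.sqrt (f (t 0))) rO.domain →
    Literature.NumberTheory.Transcendental.KZ.of Ctgt - Literature.NumberTheory.Transcendental.KZ.of Csrc
      - Literature.NumberTheory.Transcendental.KZ.of rO ∈ Literature.NumberTheory.Transcendental.KZ.relations := by
  intro g₂ g₃ e₁ al ar b c b' c' Cb f τ τ' Qf Csrc Ctgt rO hf h₂ h₃ hal har hb hc hb' hc' he₁ he₁al _halar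
    he₁b hbc he₁b' _hb'c' hfpos hCb hintA hintB hτmono hτimg hτder hτsa hQfsa hQfc hQfd hSd hSi hTd hTi
    hOd hOi
  -- positivity of `f` on the three intervals, `τ` maps `(b,c)` into `(b′,c′)`
  have hfA : ∀ x ∈ Set.Ioo al ar, 0 < f x := fun x hx => hfpos x (he₁al.trans hx.1)
  have hfB : ∀ x ∈ Set.Ioo b c, 0 < f x := fun x hx => hfpos x (he₁b.trans hx.1)
  have hfB' : ∀ x ∈ Set.Ioo b' c', 0 < f x := fun x hx => hfpos x (he₁b'.trans_lt hx.1)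
  have hτB : ∀ x ∈ Set.Ioo b c, τ x ∈ Set.Ioo b' c' := fun x hx => by
    rw [← hτimg]
    exact Set.mem_image_of_mem τ hx
  -- the `ℚ`-semialgebraic slabs `A = A′ = (al,ar)`, `B = (b,c)`, `B′ = (b′,c′)`, `J = [b,c]`
  have hAsa : IsSemialgebraic ℚ {t : Fin 1 → ℝ | t 0 ∈ Set.Ioo al ar} := isSemialgebraic_logIvl hal har
  have hBsa : IsSemialgebraic ℚ {t : Fin 1 → ℝ | t 0 ∈ Set.Ioo b c} := isSemialgebraic_logIvl hb hc
  have hB'sa : IsSemialgebraic ℚ {t : Fin 1 → ℝ | t 0 ∈ Set.Ioo b' c'} :=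
    isSemialgebraic_logIvl hb' hc'
  have hJsa : IsSemialgebraic ℚ {t : Fin 1 → ℝ | t 0 ∈ Set.Icc b c} :=
    cornerLower_isSemialgebraic_slab hb hc
  -- the maps `φ = id`, `ψ = τ`
  have hφsa : IsSemialgebraicFunOn ℚ {t : Fin 1 → ℝ | t 0 ∈ Set.Ioo al ar} (fun t => t 0) :=
    (isSemialgebraicFunOn_aeval hAsa (X 0)).congr fun t _ => by simp
  have hφinj : Set.InjOn (fun x : ℝ => x) (Set.Ioo al ar) := fun _ _ _ _ h => h
  have hψinj : Set.InjOn τ (Set.Ioo b c) := hτmono.injOn.mono Set.Ioo_subset_Icc_self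
  have hφmaps : Set.MapsTo (fun x : ℝ => x) (Set.Ioo al ar) (Set.Ioo al ar) := fun _ hx => hx
  have hψmaps : Set.MapsTo τ (Set.Ioo b c) (Set.Ioo b' c') := fun x hx => hτB x hx
  have hφder : ∀ x ∈ Set.Ioo al ar, HasDerivAt (fun x : ℝ => x) (1 : ℝ) x ∧
      (Real.sqrt (f x))⁻¹ * |(1 : ℝ)| = (Real.sqrt (f x))⁻¹ :=
    fun x _ => ⟨hasDerivAt_id' x, by rw [abs_one, mul_one]⟩
  -- the Haar identity `(√f(τ x′))⁻¹ |τ′ x′| = (√f x′)⁻¹`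
  have hψder : ∀ x ∈ Set.Ioo b c, HasDerivAt τ (τ' x) x ∧
      (Real.sqrt (f (τ x)))⁻¹ * |τ' x| = (Real.sqrt (f x))⁻¹ := fun x hx => by
    obtain ⟨hd, hhaar⟩ := hτder x hx
    refine ⟨hd, ?_⟩
    have hs' : 0 < Real.sqrt (f (τ x)) := Real.sqrt_pos.2 (hfB' _ (hτB x hx))
    have ha : |τ' x| ≠ 0 := by
      intro h0
      rw [h0, zero_mul] at hhaar
      exact hs'.ne hhaar
    rw [← hhaar, mul_comm (|τ' x|) (Real.sqrt (f x)), mul_inv, inv_mul_cancel_right₀ ha]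
  -- the weights `1/√f`
  have hwA : IsSemialgebraicFunOn ℚ {t : Fin 1 → ℝ | t 0 ∈ Set.Ioo al ar}
      (fun t => (Real.sqrt (f (t 0)))⁻¹) :=
    (isSemialgebraicFunOn_sqrt_cubic_apply hAsa h₂ h₃ hf 0).inv fun t ht =>
      (Real.sqrt_pos.2 (hfA _ ht)).ne'
  have hwB : IsSemialgebraicFunOn ℚ {t : Fin 1 → ℝ | t 0 ∈ Set.Ioo b c}
      (fun t => (Real.sqrt (f (t 0)))⁻¹) :=
    (isSemialgebraicFunOn_sqrt_cubic_apply hBsa h₂ h₃ hf 0).inv fun t ht =>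
      (Real.sqrt_pos.2 (hfB _ ht)).ne'
  have hwB' : IsSemialgebraicFunOn ℚ {t : Fin 1 → ℝ | t 0 ∈ Set.Ioo b' c'}
      (fun t => (Real.sqrt (f (t 0)))⁻¹) :=
    (isSemialgebraicFunOn_sqrt_cubic_apply hB'sa h₂ h₃ hf 0).inv fun t ht =>
      (Real.sqrt_pos.2 (hfB' _ ht)).ne'
  have hwAnn : ∀ x ∈ Set.Ioo al ar, 0 ≤ (Real.sqrt (f x))⁻¹ := fun x _ =>
    inv_nonneg.2 (Real.sqrt_nonneg _)
  have hwBnn : ∀ x ∈ Set.Ioo b c, 0 ≤ (Real.sqrt (f x))⁻¹ := fun x _ =>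
    inv_nonneg.2 (Real.sqrt_nonneg _)
  -- the kernels `h` on `B`, `B′`
  have hkB : IsSemialgebraicFunOn ℚ {t : Fin 1 → ℝ | t 0 ∈ Set.Ioo b c}
      (fun t => (g₂ * t 0 + 2 * g₃) / (4 * t 0 ^ 2)) :=
    cellStep_isSemialgebraicFunOn_kernel hBsa h₂ h₃ fun t ht => (he₁.trans (he₁b.trans ht.1)).ne'
  have hkB' : IsSemialgebraicFunOn ℚ {t : Fin 1 → ℝ | t 0 ∈ Set.Ioo b' c'}
      (fun t => (g₂ * t 0 + 2 * g₃) / (4 * t 0 ^ 2)) :=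
    cellStep_isSemialgebraicFunOn_kernel hB'sa h₂ h₃ fun t ht =>
      (he₁.trans (he₁b'.trans_lt ht.1)).ne'
  have hkBb : ∀ x ∈ Set.Ioo b c, |(g₂ * x + 2 * g₃) / (4 * x ^ 2)| ≤ Cb := fun x hx =>
    hCb x (he₁b.trans hx.1)
  have hkB'b : ∀ x ∈ Set.Ioo b' c', |(g₂ * x + 2 * g₃) / (4 * x ^ 2)| ≤ Cb := fun x hx =>
    hCb x (he₁b'.trans_lt hx.1)
  -- the constant fibres `(b, c)` and the potential `Qf`
  have hcsa : IsSemialgebraicFunOn ℚ {t : Fin 1 → ℝ | t 0 ∈ Set.Ioo al ar} (fun _ => b) :=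
    isSemialgebraicFunOn_const_of_isAlgebraic hAsa hb
  have hdsa : IsSemialgebraicFunOn ℚ {t : Fin 1 → ℝ | t 0 ∈ Set.Ioo al ar} (fun _ => c) :=
    isSemialgebraicFunOn_const_of_isAlgebraic hAsa hc
  have hcd : ∀ x ∈ Set.Ioo al ar, b < c := fun _ _ => hbc
  have hJcd : ∀ x ∈ Set.Ioo al ar, Set.Icc b c ⊆ Set.Icc b c := fun _ _ => Subset.rfl
  have hBcd : ∀ x ∈ Set.Ioo al ar, Set.Ioo b c ⊆ Set.Ioo b c := fun _ _ => Subset.rfl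
  have hQc : ∀ x ∈ Set.Ioo al ar, ContinuousOn Qf (Set.Icc b c) := fun _ _ => hQfc
  have hQd : ∀ x ∈ Set.Ioo al ar, ∀ x' ∈ Set.Ioo b c, HasDerivAt Qf
      (-(((g₂ * τ x' + 2 * g₃) / (4 * τ x' ^ 2) - (g₂ * x' + 2 * g₃) / (4 * x' ^ 2)) *
        (Real.sqrt (f x'))⁻¹)) x' := fun _ _ x' hx' =>
    (hQfd x' hx').congr_deriv (by rw [div_neg, div_eq_mul_inv])
  -- the three representations in the shape of `stub_translationStep`
  have hSd' : Csrc.domain = {z | z 0 ∈ Set.Ioo al ar ∧ b < z 1 ∧ z 1 < c} := hSd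
  have hSi' : Set.EqOn Csrc.integrand (fun z => (g₂ * z 1 + 2 * g₃) / (4 * z 1 ^ 2) *
      (Real.sqrt (f (z 0)))⁻¹ * (Real.sqrt (f (z 1)))⁻¹) Csrc.domain := fun z hz => by
    rw [hSi hz]
    ring
  have hTd' : Ctgt.domain =
      (fun z : Fin 2 → ℝ => (![z 0, τ (z 1)] : Fin 2 → ℝ)) '' Csrc.domain := by
    rw [hTd, hSd]
    exact cellStep_image_box hτimg
  have hTi' : Set.EqOn Ctgt.integrand (fun z => (g₂ * z 1 + 2 * g₃) / (4 * z 1 ^ 2) *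
      (Real.sqrt (f (z 0)))⁻¹ * (Real.sqrt (f (z 1)))⁻¹) Ctgt.domain := fun z hz => by
    rw [hTi hz]
    ring
  have hOd' : rO.domain = {t | t 0 ∈ Set.Ioo al ar} := hOd
  have hOi' : Set.EqOn rO.integrand (fun t => (Qf b - Qf c) * (Real.sqrt (f (t 0)))⁻¹)
      rO.domain := fun t ht => by
    rw [hOi ht]
    exact div_eq_mul_inv _ _
  exact stub_translationStep (fun x => x) (fun _ => 1) τ τ'
    (fun x => (g₂ * x + 2 * g₃) / (4 * x ^ 2)) (fun x => (g₂ * x + 2 * g₃) / (4 * x ^ 2))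
    (fun t => (Real.sqrt (f t))⁻¹) (fun t => (Real.sqrt (f t))⁻¹) (fun t => (Real.sqrt (f t))⁻¹)
    (fun t => (Real.sqrt (f t))⁻¹) Qf (fun _ => b) (fun _ => c) (Set.Ioo al ar) (Set.Ioo b c)
    (Set.Ioo al ar) (Set.Ioo b' c') (Set.Icc b c) Cb Csrc Ctgt rO hAsa hBsa hAsa hB'sa hJsa hφsa hτsa
    hφinj hψinj hφmaps hψmaps hφder hψder hwA hwB hwA hwB' hkB hkB' hkBb hkB'b hwAnn hwBnn hintA hintB
    hcsa hdsa hcd hJcd hBcd hQfsa hQc hQd hSd' hSi' hTd' hTi' hOd' hOi'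

end Summit.KontsevichZagierPeriods.KontsevichZagierPeriods.Cruxes.NeronTorsionSector.Translation

end
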